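import Summits.AnomalousDissipation.AnomalousDissipation.Theorems.SolenoidalFractalHomogenisationLagrangianStepCellLawVOddGainDefectSlotScalars
import HarnessLib

/-!
# K1L `LagrangianRenormalisationStep(Design)` (K1L_D, stmt-AnomalousDissipation-27980; aside 24912), stub `stub_cellLawV0_IS`
# — W5 EVEN half for SECTORIAL backgrounds: the quasi-static pinch of `excQS W M S` without symmetry of `S`
# (helper; `--supports stmt-AnomalousDissipation-27980`; word-independent)

Summits-side helper file of route `SolenoidalFractalHomogenisation` (prover seat `ad-k1l-cellLawV-w1` g2).  The worker's W2 pinch `qsPinch W M`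
(p644278, `LoewnerWindowSketch` S2) pinches the transverse symbol of the quasi-static excess, `gainForm(b)/b ≤ symb (excQS W M S) q p ≤ gainForm(a)/a`,
for SYMMETRIC backgrounds (`OddSmall S 0`).  In the SECTORIAL window (`OddSectorial S τ`, v2′ registry) the background is not symmetric; this file
gives the even pinch there, for EVERY word `W`, `M ≥ 0`, window `0 < lo ≤ 1 ≤ hi` (`T_s = 4π²|m_s|²Mτ_s`, `f = qsRespScalar`, `g = qsRespMoment`):
* **`symb_excQS_le_of_nearIso`** — the UPPER half `symb (excQS W M S) q p ≤ gainForm W M lo q p / lo` needs NO symmetry and NO sector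
  (`NearIso S lo hi` only): p5 §5's `qsResp_window_upper` (contractivity) slot by slot;
* **`le_symb_excQS_of_sectorial`** — the LOWER half `(1 − δ)·gainForm W M hi q p / hi ≤ symb (excQS W M S) q p` for `OddSectorial S τ`, given
  per slot `(τhi/2)·g_{T_s}(lo) ≤ δ·f_{T_s}(hi)` (`lowerEdgeTarget_holds`, p654671);
* **`le_symb_excQS_of_design`** — the same with the slot scalars eliminated (`qsRespMoment_le`, `le_qsRespScalar`, p655589): for a lower bound
  `T₀ > 0` of the `T_s` and `ϑ_∞ = 1 − 4ρ/3` (`ρ = W.ramp`), the single NUMERICAL inequality `(τhi/2)·ϑ_∞/lo² ≤ δ·(ϑ_∞ − 2/(ρ(T₀hi)²))/hi`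
  suffices (read-off: `δ ≈ τ·hi³/(2lo²) = τΛV⁵/2` for the window `[1/ΛV, ΛV]`).
Everything PROVED, no definition, no named fact, no sorry.  Infrastructure for route-1's rung leaf F-D1.A0 (frontier FORMAL rung); NOT a proof of the
stub, of the crux, of Onsager's conjecture or of anomalous dissipation.  Prover seat `ad-k1l-cellLawV-w1` g2, 2026-08-28.
-/

set_option linter.dupNamespace false

noncomputable section

namespace Summit.AnomalousDissipation.AnomalousDissipation.Theorems.SolenoidalFractalHomogenisation.LagrangianStep.OddGain

open Matrix Finset MeasureTheory Set
open Literature.Analysis Literature.Analysis.FunctionSpaces Literature.Analysis.FluidPDE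
open Literature.Analysis.FluidPDE.LatticeShear

/-! ## §7 The quasi-static pinch of `excQS` for sectorial backgrounds -/

section SectorialPinch

variable {k : ℕ}

/-- `|P_n p|² = Σpᵢ² − (Σ pᵢnᵢ)²` in the `⬝ᵥ` currency (p643421 `sum_sq_projPerp_mulVec`). [folklore] -/
theorem dotProduct_projPerp_self_eq {n : Fin 3 → ℝ} (hn : ∑ a, n a ^ 2 = 1) (p : Fin 3 → ℝ) :
    ((projPerp n) *ᵥ p) ⬝ᵥ ((projPerp n) *ᵥ p) = ∑ i, p i ^ 2 - (∑ i, p i * n i) ^ 2 := by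
  rw [self_dotProduct_eq_sum_sq]
  exact sum_sq_projPerp_mulVec hn p

/-- **UPPER HALF OF THE QUASI-STATIC PINCH, no symmetry, no sector**: for every word `W`, `M ≥ 0`, `0 < lo ≤ 1 ≤ hi` and every background
`S` with `NearIso S lo hi`: `symb (excQS W M S) q p ≤ gainForm W M lo q p / lo` for ALL `q p` (contractivity of the regularised blocks,
p5 §5 `qsResp_window_upper`, slot by slot). [folklore] -/
theorem symb_excQS_le_of_nearIso (W : LatticeShear.LatticeWord k) {M : ℝ} (hM : 0 ≤ M) {S : Torus.Visc4 (Fin 3)} {lo hi : ℝ}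
    (hlo : 0 < lo) (hlo1 : lo ≤ 1) (hhi1 : 1 ≤ hi) (hS : Torus.NearIso S lo hi) (q p : Fin 3 → ℝ) :
    Torus.symb (excQS W M S) q p ≤ gainForm W M lo q p / lo := by
  rw [symb_excQS, gainForm_div W M hlo.ne' q p]
  refine Finset.sum_le_sum fun s _ => ?_
  refine mul_le_mul_of_nonneg_left ?_ (mul_nonneg (slotCoef_nonneg W s) (sq_nonneg _))
  rw [slotQ_form_eq, ← dotProduct_projPerp_self_eq (sum_mhat_sq (W.phase s)) p]
  exact qsResp_window_upper (slotT_nonneg hM W s) (fun x => (window_regBlock (sum_mhat_sq _) hS hlo1 hhi1 x).1) _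

/-- **LOWER HALF OF THE QUASI-STATIC PINCH FOR SECTORIAL BACKGROUNDS**: for every word `W`, `M ≥ 0`, `0 < lo ≤ 1 ≤ hi`, `τ ≥ 0` and every
background `S` with `NearIso S lo hi` in the Kato sector `OddSectorial S τ`: if per slot `(τhi/2)·g_{T_s}(lo) ≤ δ·f_{T_s}(hi)`, then
`(1 − δ)·gainForm W M hi q p / hi ≤ symb (excQS W M S) q p` for ALL `q p` (`lowerEdgeTarget_holds` on the regularised blocks, which inherit the
sector and the window: k3l g4's `sectorForm_regBlock` / `window_regBlock`). [folklore] -/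
theorem le_symb_excQS_of_sectorial (W : LatticeShear.LatticeWord k) {M : ℝ} (hM : 0 ≤ M) {S : Torus.Visc4 (Fin 3)} {lo hi τ δ : ℝ}
    (hlo : 0 < lo) (hlo1 : lo ≤ 1) (hhi1 : 1 ≤ hi) (hτ : 0 ≤ τ) (hS : Torus.NearIso S lo hi) (hodd : OddSectorial S τ)
    (hδ : ∀ s : Fin k, τ * hi / 2 * qsRespMoment W.ramp (4 * Real.pi ^ 2 * ‖Torus.latticeVec (W.phase s).m‖ ^ 2 * M * (W.phase s).τ) lo ≤
      δ * qsRespScalar W.ramp (4 * Real.pi ^ 2 * ‖Torus.latticeVec (W.phase s).m‖ ^ 2 * M * (W.phase s).τ) hi)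
    (q p : Fin 3 → ℝ) :
    (1 - δ) * (gainForm W M hi q p / hi) ≤ Torus.symb (excQS W M S) q p := by
  have hhi : 0 < hi := by linarith
  rw [symb_excQS, gainForm_div W M hhi.ne' q p, Finset.mul_sum]
  refine Finset.sum_le_sum fun s _ => ?_
  have hn := sum_mhat_sq (W.phase s)
  have hcoef : 0 ≤ slotCoef W s * (∑ a, (W.phase s).e a * q a) ^ 2 := mul_nonneg (slotCoef_nonneg W s) (sq_nonneg _)
  have hP : 0 ≤ ∑ i, p i ^ 2 - (∑ i, p i * mhat (W.phase s) i) ^ 2 := by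
    rw [← sum_sq_projPerp_mulVec hn p]; exact Finset.sum_nonneg fun i _ => sq_nonneg _
  have hlow := lowerEdgeTarget_holds W.ramp _ (slotT_nonneg hM W s) (regBlock S (mhat (W.phase s))) τ lo hi hτ hlo
    (sectorForm_regBlock hn hS hlo.le hodd) (window_regBlock hn hS hlo1 hhi1) ((projPerp (mhat (W.phase s))) *ᵥ p)
  rw [dotProduct_projPerp_self_eq hn p] at hlow
  rw [slotQ_form_eq]
  calc (1 - δ) * (slotCoef W s * (∑ a, (W.phase s).e a * q a) ^ 2 *
        (qsRespScalar W.ramp (4 * Real.pi ^ 2 * ‖Torus.latticeVec (W.phase s).m‖ ^ 2 * M * (W.phase s).τ) hi *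
          (∑ i, p i ^ 2 - (∑ i, p i * mhat (W.phase s) i) ^ 2)))
      = slotCoef W s * (∑ a, (W.phase s).e a * q a) ^ 2 *
          (((1 - δ) * qsRespScalar W.ramp (4 * Real.pi ^ 2 * ‖Torus.latticeVec (W.phase s).m‖ ^ 2 * M * (W.phase s).τ) hi) *
            (∑ i, p i ^ 2 - (∑ i, p i * mhat (W.phase s) i) ^ 2)) := by ring
    _ ≤ slotCoef W s * (∑ a, (W.phase s).e a * q a) ^ 2 *
          ((qsRespScalar W.ramp (4 * Real.pi ^ 2 * ‖Torus.latticeVec (W.phase s).m‖ ^ 2 * M * (W.phase s).τ) hi -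
              τ * hi / 2 * qsRespMoment W.ramp (4 * Real.pi ^ 2 * ‖Torus.latticeVec (W.phase s).m‖ ^ 2 * M * (W.phase s).τ) lo) *
            (∑ i, p i ^ 2 - (∑ i, p i * mhat (W.phase s) i) ^ 2)) := by
        refine mul_le_mul_of_nonneg_left (mul_le_mul_of_nonneg_right ?_ hP) hcoef
        linarith [hδ s]
    _ ≤ _ := mul_le_mul_of_nonneg_left hlow hcoef

/-- **LOWER HALF FROM ONE NUMERICAL INEQUALITY** (slot scalars eliminated by p655589's `qsRespMoment_le`, `le_qsRespScalar`): with `ρ = W.ramp`,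
`ϑ_∞ = 1 − 4ρ/3`, a lower bound `T₀ > 0` of the slot relaxations and `δ ≥ 0`, the inequality
`(τhi/2)·ϑ_∞/lo² ≤ δ·(ϑ_∞ − 2/(ρ(T₀hi)²))/hi` gives `(1 − δ)·gainForm W M hi q p / hi ≤ symb (excQS W M S) q p`. [folklore] -/
theorem le_symb_excQS_of_design (W : LatticeShear.LatticeWord k) {M : ℝ} (hM : 0 ≤ M) {S : Torus.Visc4 (Fin 3)} {lo hi τ δ T₀ : ℝ}
    (hlo : 0 < lo) (hlo1 : lo ≤ 1) (hhi1 : 1 ≤ hi) (hτ : 0 ≤ τ) (hδ0 : 0 ≤ δ) (hT₀ : 0 < T₀)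
    (hTs : ∀ s : Fin k, T₀ ≤ 4 * Real.pi ^ 2 * ‖Torus.latticeVec (W.phase s).m‖ ^ 2 * M * (W.phase s).τ)
    (hδ : τ * hi / 2 * ((1 - 4 * W.ramp / 3) / lo ^ 2) ≤ δ * ((1 - 4 * W.ramp / 3 - 2 / (W.ramp * (T₀ * hi) ^ 2)) / hi))
    (hS : Torus.NearIso S lo hi) (hodd : OddSectorial S τ) (q p : Fin 3 → ℝ) :
    (1 - δ) * (gainForm W M hi q p / hi) ≤ Torus.symb (excQS W M S) q p := by
  have hρ := W.ramp_pos
  have hρ2 := W.ramp_le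
  have hhi : 0 < hi := by linarith
  refine le_symb_excQS_of_sectorial W hM hlo hlo1 hhi1 hτ hS hodd (fun s => ?_) q p
  set T := 4 * Real.pi ^ 2 * ‖Torus.latticeVec (W.phase s).m‖ ^ 2 * M * (W.phase s).τ with hTdef
  have hT : T₀ ≤ T := hTs s
  have hTpos : 0 < T := hT₀.trans_le hT
  have hglo : qsRespMoment W.ramp T lo ≤ (1 - 4 * W.ramp / 3) / lo ^ 2 := qsRespMoment_le hρ hρ2 hTpos.le hlo
  have hfhi : (1 - 4 * W.ramp / 3 - 2 / (W.ramp * (T₀ * hi) ^ 2)) / hi ≤ qsRespScalar W.ramp T hi := by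
    refine le_trans ?_ (le_qsRespScalar hρ hρ2 hTpos hhi)
    refine div_le_div_of_nonneg_right ?_ hhi.le
    have hmono : 2 / (W.ramp * (T * hi) ^ 2) ≤ 2 / (W.ramp * (T₀ * hi) ^ 2) := by
      refine div_le_div_of_nonneg_left (by norm_num) (by positivity) ?_
      refine mul_le_mul_of_nonneg_left ?_ hρ.le
      exact pow_le_pow_left₀ (by positivity) (mul_le_mul_of_nonneg_right hT hhi.le) 2
    linarith
  calc τ * hi / 2 * qsRespMoment W.ramp T lo ≤ τ * hi / 2 * ((1 - 4 * W.ramp / 3) / lo ^ 2) :=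
        mul_le_mul_of_nonneg_left hglo (by positivity)
    _ ≤ δ * ((1 - 4 * W.ramp / 3 - 2 / (W.ramp * (T₀ * hi) ^ 2)) / hi) := hδ
    _ ≤ δ * qsRespScalar W.ramp T hi := mul_le_mul_of_nonneg_left hfhi hδ0

end SectorialPinch

end Summit.AnomalousDissipation.AnomalousDissipation.Theorems.SolenoidalFractalHomogenisation.LagrangianStep.OddGain

end
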